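import Mathlib
import Literature.NumberTheory.Transcendental.NesterenkoGenericPoints
import Literature.Computability.AlgebraicComplexity.SchoenhageTauBini
import Literature.Computability.AlgebraicComplexity.StrassenMinimalBorderRank
import Summits.MatrixMultiplication.MatrixMultiplication.Theorems.FidelityWitnessesFidelityGapThreeSeventeenStubBorelFixedApolarityMoving
import Summits.MatrixMultiplication.MatrixMultiplication.Theorems.FidelityWitnessesFidelityGapThreeSeventeenStubBorelFixedApolarityApolar

/-!
# Borel-fixed border apolarity at `(⟨3,3,3⟩, 17)` — part 5: border apolarity in all degrees,
# sequential Slip form (no Borel normalisation yet)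

Crux `stmt-MatrixMultiplication-4958` (`FidelityWitnesses.FidelityGapThreeSeventeen`), line
`punctual-saturation`, stub `stub_borelFixedApolarity`, registered half `stub_borelFixedApolarity_plain`:

  `R̲(⟨3,3,3⟩) ≤ 17 ⟹ ∃ I ⊂ S = ℂ[C ⊕ A ⊕ B]`, a CANDIDATE (`IsCandidate`: trihomogeneous, generic
  Hilbert function of `17` points in EVERY multidegree, `(1,1,1)`-piece apolar to `⟨3,3,3⟩`) which is
  a SLIP LIMIT (`IsSlipLimit`: degreewise coefficientwise limit of the ideals of `17`-tuples of points
  in general position in every multidegree).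

Proof (Buczyńska–Buczyński 2021 Thm 1.2 in the sequential language of the line; CHL 2023 §2.3):
an order-`h` approximate decomposition with `17` triads over `ℂ[ε]` (`algBorderRank`, padded) is
perturbed by `ε^M · c` in all three factors towards a configuration `c` of `17` points in general
position in every degree (`Plain.exists_config_inf`, the statement of part 2 in the form consumed
here, re-derived from countable avoidance so that this file only depends on built parts); the moving
points `p_ρ(ε)` then have limit pieces `I_D = lim_{ε→0} I(p(ε))_D` of the generic dimension in every
degree (part 3), multiplicatively closed (`Ilim_mul_le`), hence the pieces of ONE trihomogeneous ideal
`I` (`Plain.span_Ilim`, the statement of part 1 for these pieces), apolar in degree `(1,1,1)` (part 4);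
and along a sequence `ε = z_k → 0` off countably many bad values the specialised configurations
`p(z_k)` are in general position in every degree while every element of `I_D` is the coefficientwise
limit of forms vanishing at `p(z_k)` (part 3).  What is NOT here: the Borel-fixed normal form
(`IsBorelStable`), the other half of `stub_borelFixedApolarity`.
-/

noncomputable section

namespace Summit.MatrixMultiplication.MatrixMultiplication.Theorems.PunctualSaturation

-- single-conjunct summit: the `Summit.<S>.<P>` prefix repeats `MatrixMultiplication` by design (D-0017)
set_option linter.dupNamespace false

open scoped BigOperators Polynomial Topology
open Polynomial Module Filter
open Literature.Computability.AlgebraicComplexity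
open Summit.MatrixMultiplication.MatrixMultiplication.Theorems.SymbolicSquare.FatBorder

namespace Plain

/-- A uniform degree bound for finitely many polynomials. [folklore] -/
theorem exists_natDegree_lt {r : ℕ} (q : Fin r → Var → ℂ[X]) (h : ℕ) :
    ∃ M, h < M ∧ ∀ ρ v, (q ρ v).natDegree < M := by
  refine ⟨(Finset.univ.sup fun ρv : Fin r × Var => (q ρv.1 ρv.2).natDegree) + h + 1, by omega,
    fun ρ v => ?_⟩
  have := Finset.le_sup (f := fun ρv : Fin r × Var => (q ρv.1 ρv.2).natDegree) (Finset.mem_univ (ρ, v))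
  simp only at this
  omega

/-- **`k` points of `C ⊕ A ⊕ B` in general position in every multidegree** (part 2, in the form
consumed below): `dim (S_D ∩ ⋂_ρ ker ev_{c_ρ}) + min (k, dim S_D) = dim S_D` for all `D`. Points are
added one at a time, each off the countably many hypersurfaces cut out by a non-zero form of each
non-zero previous piece (Baire in `ℂ^{27}`). [cite: ConnerHarperLandsberg2023, §2.3] -/
theorem exists_config_inf (k : ℕ) : ∃ c : Fin k → Var → ℂ, ∀ D : Fin 3 → ℕ,
    finrank ℂ ↥(SD D ⊓ ⨅ ρ, LinearMap.ker (MvPolynomial.aeval (c ρ)).toLinearMap) +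
      min k (finrank ℂ ↥(SD D)) = finrank ℂ ↥(SD D) := by
  classical
  haveI hfin : ∀ D : Fin 3 → ℕ, Module.Finite ℂ (SD D) := fun D =>
    Literature.RingTheory.MvPolynomial.finite_weightedHomogeneousSubmodule_of_ne_zero wt
      (fun v h => by have := congr_fun h v.1; simp [wt] at this) D
  -- countable avoidance in `ℂ^{27}`
  have havoid : ∀ {ι : Type} [Countable ι] (f : ι → S), (∀ i, f i ≠ 0) →
      ∃ x : Var → ℂ, ∀ i, MvPolynomial.eval x (f i) ≠ 0 := by
    intro ι _ f hf
    have hd : Dense (⋂ i, {x : Var → ℂ | MvPolynomial.eval x (f i) ≠ 0}) := by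
      refine dense_iInter_of_isOpen (fun i => ?_) (fun i => ?_)
      · exact (isClosed_eq (MvPolynomial.continuous_eval (f i)) continuous_const).isOpen_compl
      · have hc : {x : Var → ℂ | MvPolynomial.eval x (f i) ≠ 0} =
            {x | MvPolynomial.eval x (f i) = 0}ᶜ := by ext x; simp
        rw [hc, ← interior_eq_empty_iff_dense_compl]
        by_contra hne
        refine hf i (Literature.NumberTheory.Transcendental.Nesterenko.eq_zero_of_eval_eq_zero_of_isOpen
          (f i) isOpen_interior (Set.nonempty_iff_ne_empty.2 hne) fun z hz => ?_)
        exact (interior_subset hz : z ∈ {x : Var → ℂ | MvPolynomial.eval x (f i) = 0})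
    obtain ⟨x, hx⟩ := hd.nonempty
    exact ⟨x, fun i => (Set.mem_iInter.1 hx) i⟩
  -- a functional cuts a subspace in codimension one
  have hcodim : ∀ (W : Submodule ℂ S) [FiniteDimensional ℂ W] (φ : S →ₗ[ℂ] ℂ) {f : S},
      f ∈ W → φ f ≠ 0 → finrank ℂ ↥(W ⊓ LinearMap.ker φ) + 1 = finrank ℂ W := by
    intro W _ φ f hfW hf
    set ψ : W →ₗ[ℂ] ℂ := φ ∘ₗ W.subtype with hψ
    have hsurj : Function.Surjective ψ := fun a =>
      ⟨(a * (φ f)⁻¹) • ⟨f, hfW⟩, by simp [hψ, hf]⟩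
    have h := LinearMap.finrank_range_add_finrank_ker ψ
    rw [LinearMap.range_eq_top.2 hsurj, finrank_top, Module.finrank_self] at h
    have hk : finrank ℂ (LinearMap.ker ψ) = finrank ℂ ↥(W ⊓ LinearMap.ker φ) := by
      rw [hψ, LinearMap.ker_comp]
      exact ((Submodule.equivMapOfInjective _ W.injective_subtype _).trans
        (LinearEquiv.ofEq _ _ (Submodule.map_comap_subtype _ _))).finrank_eq
    omega
  induction k with
  | zero =>
    refine ⟨fun ρ => Fin.elim0 ρ, fun D => ?_⟩
    have htop : (⨅ ρ : Fin 0, LinearMap.ker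
        (MvPolynomial.aeval (Fin.elim0 ρ : Var → ℂ) : S →ₐ[ℂ] ℂ).toLinearMap) = ⊤ :=
      iInf_eq_top.2 fun ρ => Fin.elim0 ρ
    rw [htop, inf_top_eq, Nat.zero_min, add_zero]
  | succ k ih =>
    obtain ⟨c, hc⟩ := ih
    set W : (Fin 3 → ℕ) → Submodule ℂ S := fun D =>
      SD D ⊓ ⨅ ρ, LinearMap.ker (MvPolynomial.aeval (c ρ)).toLinearMap with hW
    haveI : ∀ D, Module.Finite ℂ (W D) := fun D =>
      Module.Finite.of_injective (Submodule.inclusion (inf_le_left : W D ≤ _))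
        (Submodule.inclusion_injective _)
    have hex : ∀ t : {D : Fin 3 → ℕ // W D ≠ ⊥}, ∃ f, f ∈ W t.1 ∧ f ≠ 0 := fun t =>
      Submodule.exists_mem_ne_zero_of_ne_bot t.2
    choose f hfW hf0 using hex
    obtain ⟨x, hx⟩ := havoid f hf0
    refine ⟨(Fin.cons x c : Fin (k + 1) → Var → ℂ), fun D => ?_⟩
    have hsplit : SD D ⊓ (⨅ ρ, LinearMap.ker
        (MvPolynomial.aeval ((Fin.cons x c : Fin (k + 1) → Var → ℂ) ρ)).toLinearMap) =
        W D ⊓ LinearMap.ker (MvPolynomial.aeval x).toLinearMap := by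
      have hinf : ∀ F : Fin (k + 1) → Submodule ℂ S, (⨅ ρ, F ρ) = F 0 ⊓ ⨅ ρ : Fin k, F ρ.succ :=
        fun F => le_antisymm (le_inf (iInf_le _ 0) (le_iInf fun ρ => iInf_le _ _))
          (le_iInf fun ρ => Fin.cases inf_le_left (fun i => inf_le_right.trans (iInf_le _ i)) ρ)
      rw [hinf]
      simp only [Fin.cons_zero, Fin.cons_succ, hW]
      ac_rfl
    rw [hsplit]
    have hcD := hc D
    by_cases hbot : W D = ⊥
    · have h0 : W D ⊓ LinearMap.ker (MvPolynomial.aeval x).toLinearMap = ⊥ := by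
        rw [hbot, bot_inf_eq]
      rw [h0, finrank_bot]
      change finrank ℂ ↥(W D) + _ = _ at hcD
      rw [hbot, finrank_bot] at hcD
      omega
    · have h1 := hcodim (W D) (MvPolynomial.aeval x).toLinearMap (hfW ⟨D, hbot⟩) (by
        simpa [MvPolynomial.coe_aeval_eq_eval] using hx ⟨D, hbot⟩)
      change finrank ℂ ↥(W D) + _ = _ at hcD
      have hpos : 0 < finrank ℂ ↥(W D) := by
        rw [pos_iff_ne_zero, Ne, Submodule.finrank_eq_zero]; exact hbot
      omega

/-- **The ideal generated by the limit pieces has exactly these pieces and is trihomogeneous** (part 1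
for the system `V D = I_D = lim I(p(ε))_D`, which satisfies `V D ≤ S_D`, `V D · S_E ≤ V (D + E)`).
[cite: ConnerHarperLandsberg2023, §2.3] -/
theorem span_Ilim {r : ℕ} (p : Fin r → Var → ℂ[X]) :
    (∀ D, piece (Ideal.span (⋃ D, (Ilim ℂ wt D p : Set S))) D = Ilim ℂ wt D p) ∧
      IsTrihomog (Ideal.span (⋃ D, (Ilim ℂ wt D p : Set S))) := by
  classical
  have hw : ∀ v : Var, ∑ l, wt v l = 1 := fun v => by simp [wt]
  set V : (Fin 3 → ℕ) → Submodule ℂ S := fun D => Ilim ℂ wt D p with hV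
  have hVle : ∀ D, V D ≤ SD D := fun D => Ilim_le
  have hmul : ∀ D E, V D * SD E ≤ V (D + E) := fun D E => Ilim_mul_le hw D E
  -- components of elements of `⨆ V D`
  have hcomp : ∀ f ∈ (⨆ D, V D), ∀ E, MvPolynomial.weightedHomogeneousComponent wt E f ∈ V E := by
    intro f hf E
    induction hf using Submodule.iSup_induction' with
    | mem D g hg =>
      rw [MvPolynomial.weightedHomogeneousComponent_of_mem (hVle D hg)]
      split_ifs with h
      · subst h; exact hg
      · exact Submodule.zero_mem _
    | zero => rw [map_zero]; exact Submodule.zero_mem _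
    | add f g _ _ hf hg => rw [map_add]; exact Submodule.add_mem _ hf hg
  -- `⨆ V D` is an ideal, equal to the span
  have hideal : ∀ (g : S) {f : S}, f ∈ (⨆ D, V D) → g * f ∈ ⨆ D, V D := by
    intro g f hf
    induction hf using Submodule.iSup_induction' with
    | mem D f hf =>
      rw [← MvPolynomial.sum_weightedHomogeneousComponent wt g,
        finsum_eq_sum _ (MvPolynomial.weightedHomogeneousComponent_finsupp g), Finset.sum_mul]
      refine Submodule.sum_mem _ fun E _ => ?_
      rw [mul_comm]
      exact Submodule.mem_iSup_of_mem (D + E) (hmul D E (Submodule.mul_mem_mul hf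
        (MvPolynomial.weightedHomogeneousComponent_mem wt g E)))
    | zero => rw [mul_zero]; exact Submodule.zero_mem _
    | add f f' _ _ hf hf' => rw [mul_add]; exact Submodule.add_mem _ hf hf'
  let J : Ideal S :=
    { carrier := (⨆ D, V D : Submodule ℂ S)
      add_mem' := fun hf hg => Submodule.add_mem _ hf hg
      zero_mem' := Submodule.zero_mem _
      smul_mem' := fun g _ hf => hideal g hf }
  have heq : ∀ f : S, f ∈ Ideal.span (⋃ D, (V D : Set S)) ↔ f ∈ ⨆ D, V D := by
    intro f
    constructor
    · intro hf
      have hle : Ideal.span (⋃ D, (V D : Set S)) ≤ J :=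
        Ideal.span_le.2 (Set.iUnion_subset fun D f hf => Submodule.mem_iSup_of_mem D hf)
      exact hle hf
    · intro hf
      induction hf using Submodule.iSup_induction' with
      | mem D g hg => exact Ideal.subset_span (Set.mem_iUnion.2 ⟨D, hg⟩)
      | zero => exact Submodule.zero_mem _
      | add f g _ _ hf hg => exact Submodule.add_mem _ hf hg
  refine ⟨fun D => ?_, fun f hf D => ?_⟩
  · ext f
    constructor
    · rintro ⟨hfI, hfD⟩
      have hf' := (heq f).1 hfI
      have h := hcomp f hf' D
      rwa [MvPolynomial.weightedHomogeneousComponent_of_mem hfD, if_pos rfl] at h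
    · intro hf
      exact ⟨(heq f).2 (Submodule.mem_iSup_of_mem D hf), hVle D hf⟩
  · exact (heq _).2 (Submodule.mem_iSup_of_mem D (hcomp f ((heq f).1 hf) D))

end Plain

open Plain in
/-- **Registered half `stub_borelFixedApolarity_plain` of `stub_borelFixedApolarity`: border apolarity
for `(⟨3,3,3⟩, 17)` in all degrees, sequential Slip form.** If `R̲(⟨3,3,3⟩) ≤ 17` then some candidate
ideal of `S = ℂ[C ⊕ A ⊕ B]` is a Slip limit. [cite: BuczynskaBuczynski2021, Thm 1.2] -/
theorem stub_borelFixedApolarity_plain :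
    algBorderRank (matMulTensor ℂ 3 3 3) ≤ 17 → ∃ I : Ideal S, IsCandidate I ∧ IsSlipLimit I := by
  intro h17
  classical
  have hw : ∀ v : Var, ∑ l, wt v l = 1 := fun v => by simp [wt]
  have hvan : ∀ (γ : Config) (D : Fin 3 → ℕ), vanishPiece γ D =
      SD D ⊓ ⨅ ρ, LinearMap.ker (MvPolynomial.aeval (γ ρ)).toLinearMap := fun γ D => by
    rw [vanishPiece, evalAt, LinearMap.ker_pi, inf_comm]
  -- (a) an order-`h` decomposition with `17` triads
  obtain ⟨h, hh⟩ := exists_algBorderRank_eq_approxRank (matMulTensor ℂ 3 3 3)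
  have hle : approxRank h (matMulTensor ℂ 3 3 3) ≤ 17 := hh ▸ h17
  obtain ⟨u, v, w, hd⟩ := exists_isApproxDecomposition_of_approxRank_le hle
  -- (b) perturb towards a configuration in general position in every degree
  obtain ⟨c, hx⟩ := exists_config_inf 17
  set q : Fin 17 → Var → ℂ[X] := fun ρ s => match s with
    | ((0 : Fin 3), ij) => u ρ ij
    | ((1 : Fin 3), ij) => v ρ ij
    | ((2 : Fin 3), ij) => w ρ ij with hq_def
  obtain ⟨M, hM, hq⟩ := exists_natDegree_lt q h
  set p : Fin 17 → Var → ℂ[X] := fun ρ s => q ρ s + X ^ M * C (c ρ s) with hp_def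
  have hd' : IsApproxDecomposition h (matMulTensor ℂ 3 3 3) (fun ρ a => p ρ (0, a))
      (fun ρ b => p ρ (1, b)) (fun ρ e => p ρ (2, e)) :=
    isApproxDecomposition_add_X_pow_mul hd hM (fun ρ a => C (c ρ (0, a)))
      (fun ρ b => C (c ρ (1, b))) (fun ρ e => C (c ρ (2, e)))
  -- (d) the ideal generated by the limit pieces
  obtain ⟨hpiece, htri⟩ := span_Ilim p
  set I : Ideal S := Ideal.span (⋃ D, (Ilim ℂ wt D p : Set S)) with hI
  -- (e) the Slip sequence
  obtain ⟨z, hz, hgp⟩ := Moving.exists_seq_tendsto (w := wt) hw hq hx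
  refine ⟨I, ⟨htri, fun D => ?_, fun f hf hf1 => ?_⟩, ⟨fun k ρ s => (p ρ s).eval (z k), fun k D => ?_,
    fun D f hf => ?_⟩⟩
  · -- generic Hilbert function
    change finrank ℂ ↥(piece I D) + _ = _
    rw [hpiece D]
    exact Moving.finrank_Ilim_add_min (w := wt) (m := D) hw hq (hx D)
  · -- apolarity
    have hf' : f ∈ piece I (fun _ => 1) := ⟨hf, hf1⟩
    rw [hpiece] at hf'
    exact Apolar.pairT_eq_zero_of_mem_Ilim p hd' hf'
  · -- general position of the specialised configurations
    rw [hvan]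
    exact hgp k D
  · -- degreewise convergence
    rw [hpiece D] at hf
    obtain ⟨fseq, h1, h2⟩ := Moving.exists_coeff_tendsto (w := wt) hw p hz hf
    refine ⟨fseq, fun k => ?_, h2⟩
    change fseq k ∈ vanishPiece (fun ρ s => (p ρ s).eval (z k)) D
    rw [hvan]
    exact h1 k

end Summit.MatrixMultiplication.MatrixMultiplication.Theorems.PunctualSaturation

end
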